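import Mathlib
import HarnessLib
import Summits.HubbardSuperconductivity.HubbardSuperconductivity.Theorems.KLProgrammeKLRegimeEnginePairTransferMemberDifference
import Summits.HubbardSuperconductivity.HubbardSuperconductivity.Theorems.KLProgrammeKLRegimeEnginePairTransferMemberResolvedDefect

/-!
# Route `KLProgramme` — ENGINE child gen 8 (stmt-HubbardSuperconductivity-20437 `KLRegimeEngineV17F2`), skeleton v2 class #5 rev 3: the ξΔ door's `Rhd` row — the
# «≥ 2 cross lines» class DIFFERENCE split at the Grassmann level («every term carries `D`») — `klmd_crossClass_sub_eq`, **`klmd_hd_sub_eq`**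
# (cell gate-hubbard-kl, seat hubbard-kl-k3c1-p1 g13, technique «composed-map remainder propagation»; companion of `…MemberDefectDiff` / `…MemberDefectDiffRows`)

WHY.  In the ξΔ door `klmd_defectDiff_le_rows` the row `Rhd ≥ ‖Hd₁ − Hd₂‖` is the difference of the two members' «≥ 2 cross lines» classes
`Hdᵢ = 𝒱₄(dblFold(Δ_{×Ċ}((e^{Δ_{×covᵢ}} − Δ_{×covᵢ})(𝓜ᵢ⁰𝓜ᵢ¹))))`, `𝓜ᵢ = e^{Δ_{covᵢ}}𝒢`, `covᵢ = S_{ψᵢ} + C_{>Λ₁} − C_{>Λ}`.  The two covariances differ by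
the constant matrix `S_D = softCovOf K (ψ₁ − ψ₂)` (`klmf_softCovOf_eq_sub_add`): `cov₁ = S_D + cov₂`.  By the semigroup (`gaussConv_add`) and the additivity of
`crossCov` / `grassmannLaplacian`, EXACTLY:
`E₁(P₁) − E₂(P₂) = E₁(ΔP) + (e^{Δ_{×S_D}} − 1)(e^{Δ_{×cov₂}}P₂) − Δ_{×S_D}P₂`, `Eᵢ = e^{Δ_{×covᵢ}} − Δ_{×covᵢ}`, `Pᵢ = 𝓜ᵢ⁰𝓜ᵢ¹`,
`ΔP = (𝓜₁ − 𝓜₂)⁰𝓜₁¹ + 𝓜₂⁰(𝓜₁ − 𝓜₂)¹`, `𝓜₁ − 𝓜₂ = (e^{Δ_{S_D}} − 1)𝓜₂` — every term carries `S_D` (a `D`-line):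
* `klmd_crossClass_sub_eq` — the identity for abstract matrices `C₁ = S + C₂`, `B`, any Grassmann element `G`, any degree `m` and labels `X`;
* **`klmd_hd_sub_eq`** — keyed on the two members of `klmd_pinnedDefect_sub_eq` (abstract `Hd₁ Hd₂` pinned by `rfl`): `Hd₁ t X − Hd₂ t X =` the split with
  `S := softCovOf K (ψ₁ − ψ₂)`, `C₂ := S_{ψ₂} + C_{>Λ_{n+1}} − C_{>Λ(t)}`, `B := ∂_Λ C_{>Λ}|_{Λ(t)}`, `G := 𝒢^K_{Λ(t)}`, `m = 4`.
Exact algebra (linearity + semigroup); nothing about the model's sizes is asserted; nothing asserts (X).3, (c), K3 or superconductivity.  0 kit · 0 lit.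
-/

noncomputable section

namespace Summit.HubbardSuperconductivity.HubbardSuperconductivity.Theorems.KLRegimeSplit

set_option linter.dupNamespace false -- summit = problem name (single-conjunct summit), D-0017

open Finset Matrix Set Literature.MathematicalPhysics.QuantumLattice Literature.Probability.LatticeModels GrassmannAlgebra
open Summit.HubbardSuperconductivity.HubbardSuperconductivity.Theorems.KLProgrammeLegKernels
open Summit.HubbardSuperconductivity.HubbardSuperconductivity.Theorems.TwoPointAssembly
open Summit.HubbardSuperconductivity.HubbardSuperconductivity.Theorems.DispersionFlow
open Summit.HubbardSuperconductivity.HubbardSuperconductivity.Theorems.KLRegimeWick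

variable (L M : ℕ) [NeZero L] (β U μ : ℝ) (K : TrigPolyC4v)

/-! ## §1 Generic: covariances differing by a constant matrix -/

/-- **`klmd_crossClass_sub_eq`** (generic): for matrices `C₁ = S + C₂`, `B` and a Grassmann element `G`, with `𝓜ᵢ = e^{Δ_{Cᵢ}}G`, `Pᵢ = 𝓜ᵢ⁰𝓜ᵢ¹`,
`Eᵢ = e^{Δ_{×Cᵢ}} − Δ_{×Cᵢ}`: `𝒱_m(dblFold Δ_{×B}(E₁P₁))(X) − 𝒱_m(dblFold Δ_{×B}(E₂P₂))(X) = 𝒱_m(dblFold Δ_{×B}(E₁ΔP + (e^{Δ_{×S}}(e^{Δ_{×C₂}}P₂) − e^{Δ_{×C₂}}P₂ − Δ_{×S}P₂)))(X)`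
with `ΔP = (e^{Δ_S}𝓜₂ − 𝓜₂)⁰𝓜₁¹ + 𝓜₂⁰(e^{Δ_S}𝓜₂ − 𝓜₂)¹` (and `𝓜₁ = e^{Δ_S}𝓜₂`). -/
theorem klmd_crossClass_sub_eq (C₁ C₂ S B : Matrix (HubbardFieldIdx L M) (HubbardFieldIdx L M) ℂ) (hC : C₁ = S + C₂) (G : HubbardGrassmann L M)
    (m : ℕ) (X : Fin m → HubbardFieldIdx L M) :
    vertexFn L M β (dblFold ℂ (grassmannLaplacian ℂ (crossCov ℂ B) ((gaussConv ℂ (crossCov ℂ C₁) - grassmannLaplacian ℂ (crossCov ℂ C₁)) (dblCopy ℂ 0 (gaussConv ℂ C₁ G) * dblCopy ℂ 1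
            (gaussConv ℂ C₁ G))))) m X -
        vertexFn L M β (dblFold ℂ (grassmannLaplacian ℂ (crossCov ℂ B) ((gaussConv ℂ (crossCov ℂ C₂) - grassmannLaplacian ℂ (crossCov ℂ C₂)) (dblCopy ℂ 0 (gaussConv ℂ C₂ G) * dblCopy ℂ
                1 (gaussConv ℂ C₂ G))))) m X =
      vertexFn L M β (dblFold ℂ (grassmannLaplacian ℂ (crossCov ℂ B)
        ((gaussConv ℂ (crossCov ℂ C₁) - grassmannLaplacian ℂ (crossCov ℂ C₁))
            (dblCopy ℂ 0 (gaussConv ℂ S (gaussConv ℂ C₂ G) - (gaussConv ℂ C₂ G)) * dblCopy ℂ 1 (gaussConv ℂ C₁ G) + dblCopy ℂ 0 (gaussConv ℂ C₂ G) * dblCopy ℂ 1 (gaussConv ℂ S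
                    (gaussConv ℂ C₂ G) - (gaussConv ℂ C₂ G))) +
          (gaussConv ℂ (crossCov ℂ S) (gaussConv ℂ (crossCov ℂ C₂) (dblCopy ℂ 0 (gaussConv ℂ C₂ G) * dblCopy ℂ 1 (gaussConv ℂ C₂ G))) - gaussConv ℂ (crossCov ℂ C₂) (dblCopy ℂ 0
                  (gaussConv ℂ C₂ G) * dblCopy ℂ 1 (gaussConv ℂ C₂ G)) - grassmannLaplacian ℂ (crossCov ℂ S) (dblCopy ℂ 0 (gaussConv ℂ C₂ G) * dblCopy ℂ 1 (gaussConv ℂ C₂ G)))))) m X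
                  := by
  -- the two carriers differ by `e^{Δ_S} − 1` on the second
  have hM : gaussConv ℂ C₁ G = gaussConv ℂ S (gaussConv ℂ C₂ G) := by rw [hC, gaussConv_add_apply]
  -- the cross operators: `E₁ Q = e^{Δ×S}(e^{Δ×C₂}Q) − (Δ×S Q + Δ×C₂ Q)`
  have hE : ∀ Q : GrassmannAlgebra ℂ (HubbardFieldIdx L M × Fin 2),
      (gaussConv ℂ (crossCov ℂ C₁) - grassmannLaplacian ℂ (crossCov ℂ C₁)) Q =
        gaussConv ℂ (crossCov ℂ S) (gaussConv ℂ (crossCov ℂ C₂) Q) - (grassmannLaplacian ℂ (crossCov ℂ S) Q + grassmannLaplacian ℂ (crossCov ℂ C₂) Q) := by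
    intro Q
    rw [hC, crossCov_add, gaussConv_add, grassmannLaplacian_add]
    simp only [LinearMap.sub_apply, LinearMap.add_apply, Module.End.mul_apply]
  -- the doubled products: `P₁ − P₂ = ΔP`
  have hP : (dblCopy ℂ 0 (gaussConv ℂ C₁ G) * dblCopy ℂ 1 (gaussConv ℂ C₁ G)) - (dblCopy ℂ 0 (gaussConv ℂ C₂ G) * dblCopy ℂ 1 (gaussConv ℂ C₂ G)) =
      (dblCopy ℂ 0 (gaussConv ℂ S (gaussConv ℂ C₂ G) - gaussConv ℂ C₂ G) * dblCopy ℂ 1 (gaussConv ℂ C₁ G) +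
        dblCopy ℂ 0 (gaussConv ℂ C₂ G) * dblCopy ℂ 1 (gaussConv ℂ S (gaussConv ℂ C₂ G) - gaussConv ℂ C₂ G)) := by
    rw [hM]; simp only [map_sub]; noncomm_ring
  -- assemble under the linear maps
  rw [← klw_vertexFn_sub, ← map_sub, ← map_sub]
  congr 2
  have key : ∀ Q₁ Q₂ : GrassmannAlgebra ℂ (HubbardFieldIdx L M × Fin 2),
      (gaussConv ℂ (crossCov ℂ C₁) - grassmannLaplacian ℂ (crossCov ℂ C₁)) Q₁ - (gaussConv ℂ (crossCov ℂ C₂) - grassmannLaplacian ℂ (crossCov ℂ C₂)) Q₂ =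
        (gaussConv ℂ (crossCov ℂ C₁) - grassmannLaplacian ℂ (crossCov ℂ C₁)) (Q₁ - Q₂) +
          (gaussConv ℂ (crossCov ℂ S) (gaussConv ℂ (crossCov ℂ C₂) Q₂) - gaussConv ℂ (crossCov ℂ C₂) Q₂ - grassmannLaplacian ℂ (crossCov ℂ S) Q₂) := by
    intro Q₁ Q₂
    rw [map_sub, hE Q₂]
    simp only [LinearMap.sub_apply]
    abel
  rw [key, hP]

/-! ## §2 Keyed on the two members of `klmd_pinnedDefect_sub_eq` -/

/-- **`klmd_hd_sub_eq`** — the `Rhd` row's object split: for the two members `ψ₁ ψ₂` (frame `K`, slice `n+1`, affine time `t`), with `Hd₁ Hd₂` the «≥ 2 cross lines»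
classes pinned by `rfl` as in `klmd_pinnedDefect_eq_resolved` / `klmd_pinnedDefect_sub_eq`: `Hd₁ t X − Hd₂ t X =` the split of `klmd_crossClass_sub_eq` at
`S = softCovOf K (ψ₁ − ψ₂)` (= `S_D`, a `D`-line in every term), `C₂ = S_{ψ₂} + C_{>Λ_{n+1}} − C_{>Λ(t)}`, `B = ∂_Λ C_{>Λ}|_{Λ(t)}`, `G = 𝒢^K_{Λ(t)}`, `m = 4`. -/
theorem klmd_hd_sub_eq (n : ℕ) (ψ₁ ψ₂ : FreqMomentum L M → ℝ)
    (Hd₁ : ℝ → (Fin 4 → HubbardFieldIdx L M) → ℂ) (hHd₁ : Hd₁ = fun t X => vertexFn L M β (dblFold ℂ (grassmannLaplacian ℂ (crossCov ℂ (Matrix.of fun X Y : HubbardFieldIdx L M => deriv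
            (fun Λ' : ℝ => hubbardCovAboveCT L M β μ 0 K Λ' X Y) (klScale klE0 n + t * (klScale klE0 (n + 1) - klScale klE0 n)))) ((gaussConv ℂ (crossCov ℂ (softCovOf L M β μ K ψ₁ +
            hubbardCovAboveCT L M β μ 0 K (klScale klE0 (n + 1)) - hubbardCovAboveCT L M β μ 0 K (klScale klE0 n + t * (klScale klE0 (n + 1) - klScale klE0 n)))) - grassmannLaplacian ℂ
            (crossCov ℂ (softCovOf L M β μ K ψ₁ + hubbardCovAboveCT L M β μ 0 K (klScale klE0 (n + 1)) - hubbardCovAboveCT L M β μ 0 K (klScale klE0 n + t * (klScale klE0 (n + 1) -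
            klScale klE0 n))))) (dblCopy ℂ 0 (gaussConv ℂ (softCovOf L M β μ K ψ₁ + hubbardCovAboveCT L M β μ 0 K (klScale klE0 (n + 1)) - hubbardCovAboveCT L M β μ 0 K (klScale klE0 n
            + t * (klScale klE0 (n + 1) - klScale klE0 n))) (hubbardEffectiveActionCT L M β U μ 0 K (klScale klE0 n + t * (klScale klE0 (n + 1) - klScale klE0 n)))) * dblCopy ℂ 1
            (gaussConv ℂ (softCovOf L M β μ K ψ₁ + hubbardCovAboveCT L M β μ 0 K (klScale klE0 (n + 1)) - hubbardCovAboveCT L M β μ 0 K (klScale klE0 n + t * (klScale klE0 (n + 1) -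
            klScale klE0 n))) (hubbardEffectiveActionCT L M β U μ 0 K (klScale klE0 n + t * (klScale klE0 (n + 1) - klScale klE0 n)))))))) 4 X)
    (Hd₂ : ℝ → (Fin 4 → HubbardFieldIdx L M) → ℂ) (hHd₂ : Hd₂ = fun t X => vertexFn L M β (dblFold ℂ (grassmannLaplacian ℂ (crossCov ℂ (Matrix.of fun X Y : HubbardFieldIdx L M => deriv
            (fun Λ' : ℝ => hubbardCovAboveCT L M β μ 0 K Λ' X Y) (klScale klE0 n + t * (klScale klE0 (n + 1) - klScale klE0 n)))) ((gaussConv ℂ (crossCov ℂ (softCovOf L M β μ K ψ₂ +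
            hubbardCovAboveCT L M β μ 0 K (klScale klE0 (n + 1)) - hubbardCovAboveCT L M β μ 0 K (klScale klE0 n + t * (klScale klE0 (n + 1) - klScale klE0 n)))) - grassmannLaplacian ℂ
            (crossCov ℂ (softCovOf L M β μ K ψ₂ + hubbardCovAboveCT L M β μ 0 K (klScale klE0 (n + 1)) - hubbardCovAboveCT L M β μ 0 K (klScale klE0 n + t * (klScale klE0 (n + 1) -
            klScale klE0 n))))) (dblCopy ℂ 0 (gaussConv ℂ (softCovOf L M β μ K ψ₂ + hubbardCovAboveCT L M β μ 0 K (klScale klE0 (n + 1)) - hubbardCovAboveCT L M β μ 0 K (klScale klE0 n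
            + t * (klScale klE0 (n + 1) - klScale klE0 n))) (hubbardEffectiveActionCT L M β U μ 0 K (klScale klE0 n + t * (klScale klE0 (n + 1) - klScale klE0 n)))) * dblCopy ℂ 1
            (gaussConv ℂ (softCovOf L M β μ K ψ₂ + hubbardCovAboveCT L M β μ 0 K (klScale klE0 (n + 1)) - hubbardCovAboveCT L M β μ 0 K (klScale klE0 n + t * (klScale klE0 (n + 1) -
            klScale klE0 n))) (hubbardEffectiveActionCT L M β U μ 0 K (klScale klE0 n + t * (klScale klE0 (n + 1) - klScale klE0 n)))))))) 4 X)
    (t : ℝ) (X : Fin 4 → HubbardFieldIdx L M) :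
    Hd₁ t X - Hd₂ t X =
      vertexFn L M β (dblFold ℂ (grassmannLaplacian ℂ (crossCov ℂ (Matrix.of fun X Y : HubbardFieldIdx L M => deriv (fun Λ' : ℝ => hubbardCovAboveCT L M β μ 0 K Λ' X Y) (klScale klE0 n
              + t * (klScale klE0 (n + 1) - klScale klE0 n))))
        ((gaussConv ℂ (crossCov ℂ (softCovOf L M β μ K ψ₁ + hubbardCovAboveCT L M β μ 0 K (klScale klE0 (n + 1)) - hubbardCovAboveCT L M β μ 0 K (klScale klE0 n + t * (klScale klE0 (n
                + 1) - klScale klE0 n)))) - grassmannLaplacian ℂ (crossCov ℂ (softCovOf L M β μ K ψ₁ + hubbardCovAboveCT L M β μ 0 K (klScale klE0 (n + 1)) - hubbardCovAboveCT L M β μ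
                0 K (klScale klE0 n + t * (klScale klE0 (n + 1) - klScale klE0 n)))))
            (dblCopy ℂ 0 (gaussConv ℂ (softCovOf L M β μ K (ψ₁ - ψ₂)) (gaussConv ℂ (softCovOf L M β μ K ψ₂ + hubbardCovAboveCT L M β μ 0 K (klScale klE0 (n + 1)) - hubbardCovAboveCT L
                    M β μ 0 K (klScale klE0 n + t * (klScale klE0 (n + 1) - klScale klE0 n))) (hubbardEffectiveActionCT L M β U μ 0 K (klScale klE0 n + t * (klScale klE0 (n + 1) -
                    klScale klE0 n)))) - (gaussConv ℂ (softCovOf L M β μ K ψ₂ + hubbardCovAboveCT L M β μ 0 K (klScale klE0 (n + 1)) - hubbardCovAboveCT L M β μ 0 K (klScale klE0 n + t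
                    * (klScale klE0 (n + 1) - klScale klE0 n))) (hubbardEffectiveActionCT L M β U μ 0 K (klScale klE0 n + t * (klScale klE0 (n + 1) - klScale klE0 n))))) * dblCopy ℂ 1
                    (gaussConv ℂ (softCovOf L M β μ K ψ₁ + hubbardCovAboveCT L M β μ 0 K (klScale klE0 (n + 1)) - hubbardCovAboveCT L M β μ 0 K (klScale klE0 n + t * (klScale klE0 (n +
                    1) - klScale klE0 n))) (hubbardEffectiveActionCT L M β U μ 0 K (klScale klE0 n + t * (klScale klE0 (n + 1) - klScale klE0 n)))) + dblCopy ℂ 0 (gaussConv ℂ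
                    (softCovOf L M β μ K ψ₂ + hubbardCovAboveCT L M β μ 0 K (klScale klE0 (n + 1)) - hubbardCovAboveCT L M β μ 0 K (klScale klE0 n + t * (klScale klE0 (n + 1) - klScale
                    klE0 n))) (hubbardEffectiveActionCT L M β U μ 0 K (klScale klE0 n + t * (klScale klE0 (n + 1) - klScale klE0 n)))) * dblCopy ℂ 1 (gaussConv ℂ (softCovOf L M β μ K
                    (ψ₁ - ψ₂)) (gaussConv ℂ (softCovOf L M β μ K ψ₂ + hubbardCovAboveCT L M β μ 0 K (klScale klE0 (n + 1)) - hubbardCovAboveCT L M β μ 0 K (klScale klE0 n + t *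
                    (klScale klE0 (n + 1) - klScale klE0 n))) (hubbardEffectiveActionCT L M β U μ 0 K (klScale klE0 n + t * (klScale klE0 (n + 1) - klScale klE0 n)))) - (gaussConv ℂ
                    (softCovOf L M β μ K ψ₂ + hubbardCovAboveCT L M β μ 0 K (klScale klE0 (n + 1)) - hubbardCovAboveCT L M β μ 0 K (klScale klE0 n + t * (klScale klE0 (n + 1) - klScale
                    klE0 n))) (hubbardEffectiveActionCT L M β U μ 0 K (klScale klE0 n + t * (klScale klE0 (n + 1) - klScale klE0 n)))))) +
          (gaussConv ℂ (crossCov ℂ (softCovOf L M β μ K (ψ₁ - ψ₂))) (gaussConv ℂ (crossCov ℂ (softCovOf L M β μ K ψ₂ + hubbardCovAboveCT L M β μ 0 K (klScale klE0 (n + 1)) -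
                  hubbardCovAboveCT L M β μ 0 K (klScale klE0 n + t * (klScale klE0 (n + 1) - klScale klE0 n)))) (dblCopy ℂ 0 (gaussConv ℂ (softCovOf L M β μ K ψ₂ + hubbardCovAboveCT L
                  M β μ 0 K (klScale klE0 (n + 1)) - hubbardCovAboveCT L M β μ 0 K (klScale klE0 n + t * (klScale klE0 (n + 1) - klScale klE0 n))) (hubbardEffectiveActionCT L M β U μ 0
                  K (klScale klE0 n + t * (klScale klE0 (n + 1) - klScale klE0 n)))) * dblCopy ℂ 1 (gaussConv ℂ (softCovOf L M β μ K ψ₂ + hubbardCovAboveCT L M β μ 0 K (klScale klE0 (n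
                  + 1)) - hubbardCovAboveCT L M β μ 0 K (klScale klE0 n + t * (klScale klE0 (n + 1) - klScale klE0 n))) (hubbardEffectiveActionCT L M β U μ 0 K (klScale klE0 n + t *
                  (klScale klE0 (n + 1) - klScale klE0 n)))))) - gaussConv ℂ (crossCov ℂ (softCovOf L M β μ K ψ₂ + hubbardCovAboveCT L M β μ 0 K (klScale klE0 (n + 1)) -
                  hubbardCovAboveCT L M β μ 0 K (klScale klE0 n + t * (klScale klE0 (n + 1) - klScale klE0 n)))) (dblCopy ℂ 0 (gaussConv ℂ (softCovOf L M β μ K ψ₂ + hubbardCovAboveCT L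
                  M β μ 0 K (klScale klE0 (n + 1)) - hubbardCovAboveCT L M β μ 0 K (klScale klE0 n + t * (klScale klE0 (n + 1) - klScale klE0 n))) (hubbardEffectiveActionCT L M β U μ 0
                  K (klScale klE0 n + t * (klScale klE0 (n + 1) - klScale klE0 n)))) * dblCopy ℂ 1 (gaussConv ℂ (softCovOf L M β μ K ψ₂ + hubbardCovAboveCT L M β μ 0 K (klScale klE0 (n
                  + 1)) - hubbardCovAboveCT L M β μ 0 K (klScale klE0 n + t * (klScale klE0 (n + 1) - klScale klE0 n))) (hubbardEffectiveActionCT L M β U μ 0 K (klScale klE0 n + t *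
                  (klScale klE0 (n + 1) - klScale klE0 n))))) - grassmannLaplacian ℂ (crossCov ℂ (softCovOf L M β μ K (ψ₁ - ψ₂))) (dblCopy ℂ 0 (gaussConv ℂ (softCovOf L M β μ K ψ₂ +
                  hubbardCovAboveCT L M β μ 0 K (klScale klE0 (n + 1)) - hubbardCovAboveCT L M β μ 0 K (klScale klE0 n + t * (klScale klE0 (n + 1) - klScale klE0 n)))
                  (hubbardEffectiveActionCT L M β U μ 0 K (klScale klE0 n + t * (klScale klE0 (n + 1) - klScale klE0 n)))) * dblCopy ℂ 1 (gaussConv ℂ (softCovOf L M β μ K ψ₂ +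
                  hubbardCovAboveCT L M β μ 0 K (klScale klE0 (n + 1)) - hubbardCovAboveCT L M β μ 0 K (klScale klE0 n + t * (klScale klE0 (n + 1) - klScale klE0 n)))
                  (hubbardEffectiveActionCT L M β U μ 0 K (klScale klE0 n + t * (klScale klE0 (n + 1) - klScale klE0 n))))))))) 4 X := by
  have hC : (softCovOf L M β μ K ψ₁ + hubbardCovAboveCT L M β μ 0 K (klScale klE0 (n + 1)) - hubbardCovAboveCT L M β μ 0 K (klScale klE0 n + t * (klScale klE0 (n + 1) - klScale klE0
          n))) =
      (softCovOf L M β μ K (ψ₁ - ψ₂)) + (softCovOf L M β μ K ψ₂ + hubbardCovAboveCT L M β μ 0 K (klScale klE0 (n + 1)) - hubbardCovAboveCT L M β μ 0 K (klScale klE0 n + t * (klScale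
              klE0 (n + 1) - klScale klE0 n))) := by
    rw [klmf_softCovOf_eq_sub_add L M β μ K ψ₁ ψ₂]; abel
  subst hHd₁ hHd₂
  exact klmd_crossClass_sub_eq L M β _ _ _ _ hC (hubbardEffectiveActionCT L M β U μ 0 K (klScale klE0 n + t * (klScale klE0 (n + 1) - klScale klE0 n))) 4 X

end Summit.HubbardSuperconductivity.HubbardSuperconductivity.Theorems.KLRegimeSplit

end
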